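import Mathlib.NumberTheory.Padics.PadicVal.Basic
import Literature.Algebra.EuclideanLattices.Encoding
import Literature.Computability.Complexity.CanonicalCodes
import Literature.Computability.Complexity.ListFoldChecks
import Literature.Computability.Complexity.StackBricksArith
import Literature.Computability.Complexity.StackBricksStrings
import HarnessLib

/-!
# Micciancio–Regev 2007, Lemma 5.5 at machine level: dividing an integer-vector code by the largest power of two (`FP`)

Topic `Computability/Cryptography` (family `pqc`), namespace
`Literature.Computability.Cryptography.SIS.OddPartFP`. Second brick of the derivation of the
GapSVP → SIS form for odd moduli of Micciancio–Regev's Thm. 5.23 ("or SIS when the modulus `q` is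
odd", authors' full version p. 28; the proved theorem
`Literature.Computability.Cryptography.MicciancioRegev2007_gapSVP_to_SIS_of_SIS'` of
`GapSVPToSISOdd.lean`, not a named fact) from its SIS′ twin, the named fact
`Literature.Computability.Cryptography.MicciancioRegev2007_gapSVP_to_SIS'` (`SIS.lean`): the
"moreover" clause of MR07 **Lemma 5.5** — "there is a polynomial time
algorithm that on input a solution to a SIS instance, outputs a solution to the same SIS′
instance", namely "compute the largest power `i` such that `2^i` divides all the coordinates of
`z`, and output `z/2^i`" (authors' full version, p. 18). Solutions are READ by the tree's total
decoder `Literature.Algebra.EuclideanLattices.decodeIntVec m` (`Encoding.lean`; junk `0` on words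
that are not codes of dimension-`m` vectors), so the transformation has to act correctly on EVERY
string an average-case SIS solver may print, not only on canonical codes. This file writes it as a
total string function `oddPartFn` in the tree's algebra of `FP` functions (no machine is written)
and proves, for all `m` and all strings `w`,

  `decodeIntVec m (oddPartFn w) = fun i => decodeIntVec m w i / 2^i`,
  `i = ν₂(gcd of the |coordinates| of decodeIntVec m w)`            (`decodeIntVec_oddPartFn`),

together with `oddPartFn ∈ FP` (`oddPartFn_mem_FP`). The right-hand side is literally
`SIS.oddPart (decodeIntVec m w)` of the sibling `SISOddPart.lean` (kept import-independent; the
bridge is a definitional unfolding, done in `GapSVPToSISOdd.lean`).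

## The function

All decoders of the integer-vector code `intVecEncoding = sigmaBool (encodingFinVec encodingIntBool ·)`
are total (`decodeNat`, `unaryDecodeNat = length`, `boolUnpair`, `decodeBool`), so
`decodeIntVec m w` has the closed form `decodeIntVec_eq`: with `N = decodeNat (fst w)`,
`k = |fst (snd w)|` and the `k` items read off `snd (snd w)` by `boolUnpair`
(`NegCNF.decList CanonCode.decInt k`), it is the vector of items if `N = m = k` and `0` otherwise.
`oddPartFn` is the composite of

1. `canonIV` — the canonical re-encoding `⟨bin N, ⟨1ᵏ, encList [codes of the k items]⟩⟩`
   (`CanonCode.canonPairFn canonF (canonListFn canonIntFn)` of `CanonicalCodes.lean`), which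
   decodes as `w` does;
2. `gcdFold` — the left fold `G = gcd(… gcd(0, |z₀|) …, |z_{k-1}|)` over the items
   (`Brick.foldFn` of `ListFoldBricks.lean` with the step `Brick.gcdFn` of `StackBricksArith.lean`);
3. `divisorF` — the numeral of `D = gcd(G, 2^L) = 2^{ν₂(G)}`, `L` the length of the canonical code
   (`gcd_two_pow_eq`; every magnitude is a substring, so `ν₂(G) < L`);
4. `divFold` — the fold emitting, item by item, the framed code `⟨sign, bin (|zⱼ| / D)⟩`
   (`Brick.divFn`), and `finish` — the two headers put back in front.

Each stage has its value on all inputs (`_apply` lemmas) and its membership in `FP` (fold steps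
with the total growth bounds `FoldGrowth 1` / `FoldGrowth 6`).

## References

* D. Micciancio, O. Regev, *Worst-case to average-case reductions based on Gaussian measures*,
  SIAM J. Comput. 37(1) (2007) 267–302; authors' full version, Lemma 5.5 and its proof (p. 18)
  [MicciancioRegev2007].
* S. Arora, B. Barak, *Computational Complexity: A Modern Approach*, CUP 2009, §0.1
  (representations of integers and tuples), §1.3 (polynomial time is closed under composition and
  bounded loops) [AroraBarak2009].
-/

noncomputable section

namespace Literature.Computability.Cryptography.SIS.OddPartFP

open _root_.Computability Literature.Computability.Complexity Brick CanonCode NegCNF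
open Literature.Algebra.EuclideanLattices (decodeIntVec intVecEncoding)

/-! ### The total form of `decodeIntVec` -/

/-- The dimension header read off any string: `decodeNat` of the first component. [folklore] -/
def hdrOf (w : List Bool) : ℕ := decodeNat (boolUnpair w).1

/-- The number of items announced by the unary header of the payload (its length). [folklore] -/
def lenOf (w : List Bool) : ℕ := (boolUnpair (boolUnpair w).2).1.length

/-- The items part of the payload. [folklore] -/
def itemsOf (w : List Bool) : List Bool := (boolUnpair (boolUnpair w).2).2

/-- The `k` integers read off the items part (`NegCNF.decList` with the total integer decoder
`CanonCode.decInt`). [folklore] -/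
def entriesOf (k : ℕ) (w : List Bool) : List ℤ := decList decInt k (itemsOf w)

/-- The list decoder of integer codes is total: `k = |unary header|` items. [folklore] -/
theorem listBool_decode (v : List Bool) :
    encodingIntBool.listBool.decode v = some (decList decInt (boolUnpair v).1.length (boolUnpair v).2) :=
  (canonListFn_eq encodingIntBool decInt decode_int canonIntFn_eq v).1

/-- **Closed form of the tree's total decoder `decodeIntVec`**: the vector of the `m` integers
read off the items part if both headers announce dimension `m`, the junk value `0` otherwise.
[cite: AroraBarak2009, §0.1 (representations)] -/
theorem decodeIntVec_eq (m : ℕ) (w : List Bool) :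
    decodeIntVec m w =
      if hdrOf w = m ∧ lenOf w = m then (fun i : Fin m => (entriesOf m w).getD i 0) else 0 := by
  have h1 : intVecEncoding.decode w =
      ((encodingIntBool.listBool.decode (boolUnpair w).2).bind fun l =>
        if h : l.length = hdrOf w then some (fun i => l.get (i.cast h.symm)) else none).map
        (Sigma.mk (hdrOf w)) := rfl
  rw [listBool_decode, Option.bind_some] at h1
  unfold decodeIntVec
  rw [h1]
  by_cases hk : lenOf w = hdrOf w
  · have hk' : (decList decInt (boolUnpair (boolUnpair w).2).1.length
        (boolUnpair (boolUnpair w).2).2).length = hdrOf w := by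
      simpa [lenOf] using hk
    rw [dif_pos hk']
    simp only [Option.map_some]
    by_cases hm : hdrOf w = m
    · subst hm
      rw [dif_pos rfl, if_pos ⟨rfl, hk⟩]
      funext i
      rw [List.getD_eq_getElem _ _ (by simp [entriesOf, itemsOf])]
      simp [entriesOf, itemsOf, List.get_eq_getElem, ← hk, lenOf]
    · rw [dif_neg hm, if_neg (fun h => hm h.1)]
  · have hk' : ¬ (decList decInt (boolUnpair (boolUnpair w).2).1.length
        (boolUnpair (boolUnpair w).2).2).length = hdrOf w := by
      simpa [lenOf] using hk
    rw [dif_neg hk']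
    simp only [Option.map_none]
    rw [if_neg]
    rintro ⟨h1, h2⟩
    exact hk (h2.trans h1.symm)

/-- Reading `|l|` items off a framed list gives the items. [folklore] -/
theorem decList_frames {α : Type} (d : List Bool → α) :
    ∀ l : List (List Bool), decList d l.length (frames l) = l.map d
  | [] => rfl
  | c :: l => by
    rw [List.length_cons, decList, boolUnpair_frames_cons, List.map_cons, decList_frames d l]

/-- Reading `k = |l|` items off a framed list gives the items. [folklore] -/
theorem decList_frames' {α : Type} (d : List Bool → α) {k : ℕ} (l : List (List Bool)) (h : l.length = k) :
    decList d k (frames l) = l.map d := by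
  subst h; exact decList_frames d l

/-- The total integer decoder on a genuine code `⟨[sign], bin t⟩`. [folklore] -/
theorem decInt_boolPair (b : Bool) (t : ℕ) :
    decInt (boolPair [b] (encodeNat t)) = if b then -(t : ℤ) else (t : ℤ) := by
  simp [decInt, decodeBool]

/-! ### Stage 1: canonical re-encoding -/

/-- The canonical re-encoding of an integer-vector code: `⟨bin N, ⟨1ᵏ, items re-encoded⟩⟩`
(`CanonicalCodes.lean`). [cite: AroraBarak2009, §0.1 (representations)] -/
def canonIV : List Bool → List Bool := canonPairFn canonF (canonListFn canonIntFn)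

/-- `canonIV ∈ FP`. [cite: AroraBarak2009, §1.3] -/
theorem canonIV_mem_FP : canonIV ∈ FP :=
  canonPairFn_mem_FP canonF_mem_FP (canonListFn_mem_FP canonIntFn_mem_FP length_canonIntFn_le)

/-- **Value of `canonIV` on every string.** [folklore] -/
theorem canonIV_apply (w : List Bool) :
    canonIV w = boolPair (encodeNat (hdrOf w)) (boolPair (unaryEncodeNat (lenOf w))
      (encList ((entriesOf (lenOf w) w).map encodingIntBool.encode))) := by
  rw [canonIV, canonPairFn_apply, canonF_eq_encodeNat_decodeNat,
    (canonListFn_eq encodingIntBool decInt decode_int canonIntFn_eq _).2, listBool_encode_eq_encList]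
  simp [hdrOf, lenOf, entriesOf, itemsOf]

/-- The sign field of the code of an integer. [folklore] -/
theorem fstF_encode_int (z : ℤ) : fstF (encodingIntBool.encode z) = [decide (z < 0)] :=
  fstF_boolPair [decide (z < 0)] (encodeNat z.natAbs)

/-- The magnitude field of the code of an integer: the canonical numeral of `|z|`. [folklore] -/
theorem sndF_encode_int (z : ℤ) : sndF (encodingIntBool.encode z) = encodeNat z.natAbs :=
  sndF_boolPair [decide (z < 0)] (encodeNat z.natAbs)

/-- The length of the code of an integer: magnitude plus four framing symbols. [folklore] -/
theorem length_encode_int (z : ℤ) : (encodingIntBool.encode z).length = (encodeNat z.natAbs).length + 4 := by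
  change (boolPair [decide (z < 0)] (encodeNat z.natAbs)).length = _
  rw [length_boolPair]; simp; omega

/-! ### Stage 2: the gcd of the magnitudes, by a fold -/

/-- The step of the gcd fold on step arguments `⟨u, ⟨a, acc⟩⟩`: `bin (gcd ⟦acc⟧ ⟦snd a⟧)`
(the magnitude of the item `a`). [folklore] -/
def gcdStep : List Bool → List Bool := gcdFn ∘ fanoutFn (sndPow 1) (sndF ∘ nthF 1)

/-- `gcdStep ∈ FP`. [folklore] -/
theorem gcdStep_mem_FP : gcdStep ∈ FP :=
  comp_mem_FP gcdFn_mem_FP (fanoutFn_mem_FP (sndPow_mem_FP 1) (comp_mem_FP sndF_mem_FP (nthF_mem_FP 1)))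

/-- Value of `gcdStep` on every string (through the projections). [folklore] -/
theorem gcdStep_eq (v : List Bool) :
    gcdStep v = encodeNat (Nat.gcd (bitsToNat (sndF (sndF v))) (bitsToNat (sndF (fstF (sndF v))))) := by
  simp [gcdStep, sndPow, nthF]

/-- Value of `gcdStep` on a step argument. [folklore] -/
theorem gcdStep_apply (u a acc : List Bool) :
    gcdStep (boolPair u (boolPair a acc)) = encodeNat (Nat.gcd (bitsToNat acc) (bitsToNat (sndF a))) := by
  rw [gcdStep_eq]; simp

/-- Growth of the gcd step: `FoldGrowth 1`. [folklore] -/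
theorem foldGrowth_gcdStep : FoldGrowth 1 gcdStep := fun v => by
  rw [gcdStep_eq]
  have h1 := length_encodeNat_le_of_le_add (gcd_le_add (bitsToNat (sndF (sndF v))) (bitsToNat (sndF (fstF (sndF v)))))
  have h2 := length_fstF_sndF_le (fstF (sndF v))
  omega

/-- The gcd fold: on `⟨x, L⟩`, the numeral of the gcd of the magnitudes of the items of `L`.
[cite: AroraBarak2009, §1.3 (bounded loops)] -/
def gcdFold : List Bool → List Bool := foldFn gcdStep fun _ => []

/-- `gcdFold ∈ FP`. [folklore] -/
theorem gcdFold_mem_FP : gcdFold ∈ FP := foldFn_mem_FP gcdStep_mem_FP (const_mem_FP []) foldGrowth_gcdStep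

/-- The numeric model of the fold: canonical numerals all along. [folklore] -/
theorem foldl_gcdStep (x L : List Bool) : ∀ (cs : List (List Bool)) (g : ℕ),
    cs.foldl (fun acc a => gcdStep (boolPair (boolPair x L) (boolPair a acc))) (encodeNat g) =
      encodeNat (cs.foldl (fun g a => Nat.gcd g (bitsToNat (sndF a))) g)
  | [], g => rfl
  | c :: cs, g => by
    rw [List.foldl_cons, List.foldl_cons, gcdStep_apply, bitsToNat_encodeNat, foldl_gcdStep x L cs]

/-- **Value of the gcd fold on a coded list.** [folklore] -/
theorem gcdFold_boolPair (x : List Bool) (cs : List (List Bool)) :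
    gcdFold (boolPair x (encList cs)) = encodeNat (cs.foldl (fun g a => Nat.gcd g (bitsToNat (sndF a))) 0) := by
  rw [gcdFold, foldFn_boolPair, decNil_encList]
  exact foldl_gcdStep x (encList cs) cs 0

/-! ### Stage 3: the divisor `D = gcd(G, 2^L)` -/

/-- `zerosF w = 0^{|w|}` (through `Brick.padTakeFn`). [folklore] -/
def zerosF : List Bool → List Bool := fstF ∘ padTakeFn ∘ fanoutFn id fun _ => []

/-- `zerosF ∈ FP`. [folklore] -/
theorem zerosF_mem_FP : zerosF ∈ FP :=
  comp_mem_FP fstF_mem_FP (comp_mem_FP padTakeFn_mem_FP (fanoutFn_mem_FP OracleCompose.id_mem_FP (const_mem_FP [])))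

/-- Value of `zerosF`. [folklore] -/
@[simp] theorem zerosF_apply (w : List Bool) : zerosF w = List.replicate w.length false := by
  simp [zerosF]

/-- `pow2Len w = 0^{|w|} 1`, a numeral of value `2^{|w|}`. [folklore] -/
def pow2Len : List Bool → List Bool := fun w => zerosF w ++ (fun _ => [true]) w

/-- `pow2Len ∈ FP`. [folklore] -/
theorem pow2Len_mem_FP : pow2Len ∈ FP := append_mem_FP zerosF_mem_FP (const_mem_FP [true])

/-- `bitsToNat (0ᴸ 1) = 2^L`. [folklore] -/
theorem bitsToNat_replicate_false_append_true : ∀ L : ℕ,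
    bitsToNat (List.replicate L false ++ [true]) = 2 ^ L
  | 0 => rfl
  | L + 1 => by
    rw [List.replicate_succ, List.cons_append, bitsToNat_cons, bitsToNat_replicate_false_append_true L, pow_succ]
    simp; ring

/-- Value of `pow2Len`. [folklore] -/
theorem bitsToNat_pow2Len (w : List Bool) : bitsToNat (pow2Len w) = 2 ^ w.length := by
  simp [pow2Len, bitsToNat_replicate_false_append_true]

/-- The divisor numeral `D = bin (gcd (G, 2^{|w₁|}))` computed from the canonical code `w₁`.
[folklore] -/
def divisorF : List Bool → List Bool := gcdFn ∘ fanoutFn (gcdFold ∘ fanoutFn id (sndF ∘ sndF)) pow2Len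

/-- `divisorF ∈ FP`. [folklore] -/
theorem divisorF_mem_FP : divisorF ∈ FP :=
  comp_mem_FP gcdFn_mem_FP (fanoutFn_mem_FP
    (comp_mem_FP gcdFold_mem_FP (fanoutFn_mem_FP OracleCompose.id_mem_FP (comp_mem_FP sndF_mem_FP sndF_mem_FP)))
    pow2Len_mem_FP)

/-- Value of `divisorF` on a canonical code `⟨h, ⟨u, encList cs⟩⟩`. [folklore] -/
theorem divisorF_apply (h u : List Bool) (cs : List (List Bool)) :
    divisorF (boolPair h (boolPair u (encList cs))) =
      encodeNat (Nat.gcd (cs.foldl (fun g a => Nat.gcd g (bitsToNat (sndF a))) 0)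
        (2 ^ (boolPair h (boolPair u (encList cs))).length)) := by
  simp only [divisorF, Function.comp_apply, fanoutFn_apply, id, sndF_boolPair, gcdFn_boolPair, gcdFold_boolPair,
    bitsToNat_encodeNat, bitsToNat_pow2Len]

/-- `withD w₁ = ⟨w₁, D⟩`. [folklore] -/
def withD : List Bool → List Bool := fanoutFn id divisorF

/-- `withD ∈ FP`. [folklore] -/
theorem withD_mem_FP : withD ∈ FP := fanoutFn_mem_FP OracleCompose.id_mem_FP divisorF_mem_FP

/-! ### Stage 4: dividing every magnitude, by a fold emitting framed items -/

/-- The new item computed on a step argument `⟨u, ⟨a, acc⟩⟩` with `u = ⟨D, L⟩`: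
`⟨fst a, bin (⟦snd a⟧ / ⟦D⟧)⟩`. [folklore] -/
def divItem : List Bool → List Bool :=
  fanoutFn (fstF ∘ nthF 1) (divFn ∘ fanoutFn (sndF ∘ nthF 1) (fstF ∘ nthF 0))

/-- `divItem ∈ FP`. [folklore] -/
theorem divItem_mem_FP : divItem ∈ FP :=
  fanoutFn_mem_FP (comp_mem_FP fstF_mem_FP (nthF_mem_FP 1))
    (comp_mem_FP divFn_mem_FP (fanoutFn_mem_FP (comp_mem_FP sndF_mem_FP (nthF_mem_FP 1))
      (comp_mem_FP fstF_mem_FP (nthF_mem_FP 0))))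

/-- Value of `divItem` on every string (through the projections). [folklore] -/
theorem divItem_eq (v : List Bool) :
    divItem v = boolPair (fstF (fstF (sndF v)))
      (encodeNat (bitsToNat (sndF (fstF (sndF v))) / bitsToNat (fstF (fstF v)))) := by
  simp [divItem, nthF]

/-- The step of the dividing fold: append the framed new item to the accumulator. [folklore] -/
def quotStep : List Bool → List Bool := fun v => sndPow 1 v ++ fanoutFn divItem (fun _ => []) v

/-- `quotStep ∈ FP`. [folklore] -/
theorem quotStep_mem_FP : quotStep ∈ FP :=
  append_mem_FP (sndPow_mem_FP 1) (fanoutFn_mem_FP divItem_mem_FP (const_mem_FP []))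

/-- Value of `quotStep` on every string. [folklore] -/
theorem quotStep_eq (v : List Bool) : quotStep v = sndF (sndF v) ++ boolPair (divItem v) [] := by
  simp [quotStep, sndPow]

/-- Value of `quotStep` on a step argument. [folklore] -/
theorem quotStep_apply (D L a acc : List Bool) :
    quotStep (boolPair (boolPair D L) (boolPair a acc)) =
      acc ++ boolPair (boolPair (fstF a) (encodeNat (bitsToNat (sndF a) / bitsToNat D))) [] := by
  rw [quotStep_eq, divItem_eq]; simp

/-- Growth of the dividing step: `FoldGrowth 6` (the quotient numeral is no longer than the
magnitude, the item is re-paired once). [folklore] -/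
theorem foldGrowth_quotStep : FoldGrowth 6 quotStep := fun v => by
  rw [quotStep_eq, divItem_eq]
  have h1 : (encodeNat (bitsToNat (sndF (fstF (sndF v))) / bitsToNat (fstF (fstF v)))).length ≤
      (sndF (fstF (sndF v))).length :=
    (length_encodeNat_mono (Nat.div_le_self _ _)).trans (length_encodeNat_bitsToNat_le _)
  have h2 := length_fstF_sndF_le (fstF (sndF v))
  simp only [List.length_append, length_boolPair, List.length_nil]
  omega

/-- The dividing fold: on `⟨D, L⟩`, the framed list of the items of `L` with magnitudes divided
by `⟦D⟧`. [cite: AroraBarak2009, §1.3 (bounded loops)] -/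
def divFold : List Bool → List Bool := foldFn quotStep fun _ => []

/-- `divFold ∈ FP`. [folklore] -/
theorem divFold_mem_FP : divFold ∈ FP := foldFn_mem_FP quotStep_mem_FP (const_mem_FP []) foldGrowth_quotStep

/-- The new item as a function of the old one. [folklore] -/
def newItem (D a : List Bool) : List Bool :=
  boolPair (fstF a) (encodeNat (bitsToNat (sndF a) / bitsToNat D))

/-- The model of the dividing fold: the accumulator collects the framed new items. [folklore] -/
theorem foldl_quotStep (D L : List Bool) : ∀ (cs : List (List Bool)) (acc : List Bool),
    cs.foldl (fun acc a => quotStep (boolPair (boolPair D L) (boolPair a acc))) acc =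
      acc ++ frames (cs.map (newItem D))
  | [], acc => by simp
  | c :: cs, acc => by
    rw [List.foldl_cons, quotStep_apply, foldl_quotStep D L cs, List.map_cons, frames_cons_eq_boolPair,
      List.append_assoc]
    congr 1
    rw [show boolPair (newItem D c) (frames (cs.map (newItem D))) =
      frames ([newItem D c] ++ cs.map (newItem D)) from (frames_cons_eq_boolPair _ _).symm,
      frames_append, show [newItem D c] = newItem D c :: [] from rfl, frames_cons_eq_boolPair, frames_nil]
    rfl

/-- **Value of the dividing fold on a coded list.** [folklore] -/
theorem divFold_boolPair (D : List Bool) (cs : List (List Bool)) :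
    divFold (boolPair D (encList cs)) = frames (cs.map (newItem D)) := by
  rw [divFold, foldFn_boolPair, decNil_encList, foldl_quotStep, List.nil_append]

/-! ### Stage 5: the headers back in front; the function -/

/-- `finish ⟨w₁, D⟩ = ⟨fst w₁, ⟨fst (snd w₁), divFold ⟨D, snd (snd w₁)⟩⟩⟩`. [folklore] -/
def finish : List Bool → List Bool :=
  fanoutFn (fstF ∘ fstF) (fanoutFn (fstF ∘ sndF ∘ fstF) (divFold ∘ fanoutFn sndF (sndF ∘ sndF ∘ fstF)))

/-- `finish ∈ FP`. [folklore] -/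
theorem finish_mem_FP : finish ∈ FP :=
  fanoutFn_mem_FP (comp_mem_FP fstF_mem_FP fstF_mem_FP)
    (fanoutFn_mem_FP (comp_mem_FP fstF_mem_FP (comp_mem_FP sndF_mem_FP fstF_mem_FP))
      (comp_mem_FP divFold_mem_FP (fanoutFn_mem_FP sndF_mem_FP
        (comp_mem_FP sndF_mem_FP (comp_mem_FP sndF_mem_FP fstF_mem_FP)))))

/-- **The transformation of MR07 Lemma 5.5 on codes of integer vectors**: re-encode canonically,
compute the divisor `D = 2^i`, divide every coordinate by `D`. [Micciancio–Regev 2007, proof of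
Lemma 5.5 ("compute the largest power `i` such that `2^i` divides all the coordinates of `z`, and
output `z/2^i`")] [cite: MicciancioRegev2007, Lemma 5.5 (proof, full version p. 18)] -/
def oddPartFn : List Bool → List Bool := finish ∘ withD ∘ canonIV

/-- **`oddPartFn ∈ FP`** — the "moreover" clause of MR07 Lemma 5.5 ("there is a polynomial time
algorithm that on input a solution to a SIS instance, outputs a solution to the same SIS′
instance"). [cite: MicciancioRegev2007, Lemma 5.5 (full version p. 18)] -/
theorem oddPartFn_mem_FP : oddPartFn ∈ FP :=
  comp_mem_FP finish_mem_FP (comp_mem_FP withD_mem_FP canonIV_mem_FP)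

/-- The gcd of the magnitudes of a list of integers, as the folds compute it. [folklore] -/
def listGcd (zs : List ℤ) : ℕ := zs.foldl (fun g z => Nat.gcd g z.natAbs) 0

/-- The divisor applied by `oddPartFn` to the entries `zs` of a canonical code of length `L`:
`gcd (listGcd zs, 2^L)`. [folklore] -/
def divisor (zs : List ℤ) (L : ℕ) : ℕ := Nat.gcd (listGcd zs) (2 ^ L)

/-- The gcd fold over the codes of integers reads their magnitudes. [folklore] -/
theorem foldl_map_encode (zs : List ℤ) :
    (zs.map encodingIntBool.encode).foldl (fun g a => Nat.gcd g (bitsToNat (sndF a))) 0 = listGcd zs := by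
  rw [listGcd, List.foldl_map]
  congr 1
  funext g z
  rw [sndF_encode_int, bitsToNat_encodeNat]

/-- **Value of `oddPartFn` on every string**: the canonical code with the same headers whose
`j`-th item is `⟨[zⱼ < 0], bin (|zⱼ| / D)⟩`, `D = divisor zs L` for the entries `zs` of `w` and
the length `L` of its canonical re-encoding. [folklore] -/
theorem oddPartFn_apply (w : List Bool) :
    oddPartFn w = boolPair (encodeNat (hdrOf w)) (boolPair (unaryEncodeNat (lenOf w))
      (frames ((entriesOf (lenOf w) w).map fun z => boolPair [decide (z < 0)]
        (encodeNat (z.natAbs / divisor (entriesOf (lenOf w) w) (canonIV w).length))))) := by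
  set zs := entriesOf (lenOf w) w with hzs
  have hc : canonIV w = boolPair (encodeNat (hdrOf w)) (boolPair (unaryEncodeNat (lenOf w))
      (encList (zs.map encodingIntBool.encode))) := canonIV_apply w
  have hD : divisorF (canonIV w) = encodeNat (divisor zs (canonIV w).length) := by
    conv_lhs => rw [hc]
    rw [divisorF_apply, foldl_map_encode, ← hc]
    rfl
  have hval : oddPartFn w = finish (boolPair (canonIV w) (divisorF (canonIV w))) := by
    simp only [oddPartFn, withD, Function.comp_apply, fanoutFn_apply, id]
  rw [hval, hD]
  set L := (canonIV w).length with hL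
  rw [hc]
  have hitems : (zs.map encodingIntBool.encode).map (newItem (encodeNat (divisor zs L))) =
      zs.map fun z => boolPair [decide (z < 0)] (encodeNat (z.natAbs / divisor zs L)) := by
    rw [List.map_map]
    exact List.map_congr_left fun z _ => by
      simp only [Function.comp_apply, newItem, fstF_encode_int, sndF_encode_int, bitsToNat_encodeNat]
  simp only [finish, fanoutFn_apply, Function.comp_apply, fstF_boolPair, sndF_boolPair, divFold_boolPair, hitems]

/-! ### The decoded output -/

/-- Headers and entries of the output. [folklore] -/
theorem decodeIntVec_oddPartFn_eq (m : ℕ) (w : List Bool) :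
    decodeIntVec m (oddPartFn w) =
      if hdrOf w = m ∧ lenOf w = m then
        (fun i : Fin m => (entriesOf m w).getD i 0 / (divisor (entriesOf m w) (canonIV w).length : ℤ))
      else 0 := by
  rw [decodeIntVec_eq]
  have hh : hdrOf (oddPartFn w) = hdrOf w := by
    rw [oddPartFn_apply, hdrOf, boolUnpair_boolPair, decode_encodeNat]
  have hl : lenOf (oddPartFn w) = lenOf w := by
    rw [oddPartFn_apply, lenOf, boolUnpair_boolPair, boolUnpair_boolPair]
    exact unary_decode_encode_nat _
  rw [hh, hl]
  by_cases hcond : hdrOf w = m ∧ lenOf w = m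
  · rw [if_pos hcond, if_pos hcond]
    obtain ⟨_, hk⟩ := hcond
    subst hk
    have hlen : (entriesOf (lenOf w) w).length = lenOf w := by simp [entriesOf]
    have hitems : entriesOf (lenOf w) (oddPartFn w) =
        (entriesOf (lenOf w) w).map fun z => z / (divisor (entriesOf (lenOf w) w) (canonIV w).length : ℤ) := by
      rw [entriesOf, itemsOf, oddPartFn_apply, boolUnpair_boolPair, boolUnpair_boolPair]
      change decList decInt (lenOf w) (frames _) = _
      rw [decList_frames' _ _ (by simp [hlen]), List.map_map]
      refine List.map_congr_left fun z hz => ?_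
      rw [Function.comp_apply, decInt_boolPair]
      simp only [decide_eq_true_eq]
      exact (ediv_eq_sign_natAbs_div z _ (divisor_dvd _ _ z hz)).symm
    funext i
    rw [hitems, List.getD_eq_getElem?_getD, List.getD_eq_getElem?_getD, List.getElem?_map]
    cases (entriesOf (lenOf w) w)[(i : ℕ)]? with
    | none => simp
    | some z => rfl
  · rw [if_neg hcond, if_neg hcond]
where
  /-- Integer division by a divisor of `z`, through sign and magnitude. [folklore] -/
  ediv_eq_sign_natAbs_div (z : ℤ) (D : ℕ) (h : (D : ℤ) ∣ z) :
      z / (D : ℤ) = if z < 0 then -((z.natAbs / D : ℕ) : ℤ) else ((z.natAbs / D : ℕ) : ℤ) := by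
    rcases Nat.eq_zero_or_pos D with rfl | hD
    · simp only [Nat.cast_zero, Int.ediv_zero, Nat.div_zero, neg_zero, ite_self]
    obtain ⟨t, rfl⟩ := h
    have hD0 : (D : ℤ) ≠ 0 := by exact_mod_cast hD.ne'
    rw [Int.mul_ediv_cancel_left _ hD0, Int.natAbs_mul, Int.natAbs_natCast, Nat.mul_div_cancel_left _ hD]
    by_cases ht : t < 0
    · rw [if_pos (by nlinarith [hD])]; omega
    · rw [if_neg (by nlinarith [hD])]; omega
  /-- The divisor divides every entry. [folklore] -/
  divisor_dvd (zs : List ℤ) (L : ℕ) (z : ℤ) (hz : z ∈ zs) : (divisor zs L : ℤ) ∣ z := by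
    have h1 : (divisor zs L : ℤ) ∣ (listGcd zs : ℤ) := Int.natCast_dvd_natCast.2 (Nat.gcd_dvd_left _ _)
    refine h1.trans ?_
    rw [← Int.dvd_natAbs, Int.natCast_dvd_natCast]
    exact (listGcd_dvd zs).2 z hz
  /-- The list gcd divides every magnitude (and its seed). [folklore] -/
  listGcd_dvd (zs : List ℤ) : listGcd zs ∣ 0 ∧ ∀ z ∈ zs, listGcd zs ∣ z.natAbs := by
    suffices H : ∀ (l : List ℤ) (a : ℕ), l.foldl (fun g z => Nat.gcd g z.natAbs) a ∣ a ∧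
        ∀ z ∈ l, l.foldl (fun g z => Nat.gcd g z.natAbs) a ∣ z.natAbs from H zs 0
    intro l
    induction l with
    | nil => intro a; simp
    | cons b l ih =>
      intro a
      obtain ⟨h1, h2⟩ := ih (Nat.gcd a b.natAbs)
      refine ⟨h1.trans (Nat.gcd_dvd_left _ _), fun z hz => ?_⟩
      simp only [List.mem_cons] at hz
      rcases hz with rfl | hz
      · exact h1.trans (Nat.gcd_dvd_right _ _)
      · exact h2 z hz

/-! ### The divisor is the largest power of two dividing all entries -/

/-- `gcd (G, 2^L) = 2^{ν₂(G)}` once `ν₂(G) ≤ L` (`G ≠ 0`). [folklore] -/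
theorem gcd_two_pow_eq {G L : ℕ} (hG : G ≠ 0) (hL : padicValNat 2 G ≤ L) :
    Nat.gcd G (2 ^ L) = 2 ^ padicValNat 2 G := by
  haveI : Fact (Nat.Prime 2) := ⟨Nat.prime_two⟩
  obtain ⟨j, hjL, hj⟩ := (Nat.dvd_prime_pow Nat.prime_two).1 (Nat.gcd_dvd_right G (2 ^ L))
  rw [hj]
  have h1 : j ≤ padicValNat 2 G :=
    (padicValNat_dvd_iff_le hG).1 (hj ▸ Nat.gcd_dvd_left G (2 ^ L))
  have h2 : 2 ^ padicValNat 2 G ∣ 2 ^ j :=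
    hj ▸ Nat.dvd_gcd pow_padicValNat_dvd (pow_dvd_pow 2 hL)
  have h3 := (Nat.pow_dvd_pow_iff_le_right one_lt_two).1 h2
  rw [le_antisymm h1 h3]

/-- A common divisor of all magnitudes divides the list gcd. [folklore] -/
theorem dvd_listGcd {d : ℕ} (zs : List ℤ) (h : ∀ z ∈ zs, d ∣ z.natAbs) : d ∣ listGcd zs := by
  suffices H : ∀ (l : List ℤ) (a : ℕ), d ∣ a → (∀ z ∈ l, d ∣ z.natAbs) →
      d ∣ l.foldl (fun g z => Nat.gcd g z.natAbs) a from H zs 0 (dvd_zero d) h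
  intro l
  induction l with
  | nil => intro a ha _; simpa using ha
  | cons b l ih =>
    intro a ha hl
    simp only [List.foldl_cons]
    exact ih _ (Nat.dvd_gcd ha (hl b (by simp))) fun x hx => hl x (by simp [hx])

/-- Every magnitude numeral sits inside the canonical code: `|bin |z|| ≤ |canonIV w|` for an entry
`z` of `w`. [folklore] -/
theorem length_encodeNat_natAbs_le (w : List Bool) {z : ℤ} (hz : z ∈ entriesOf (lenOf w) w) :
    (encodeNat z.natAbs).length ≤ (canonIV w).length := by
  rw [canonIV_apply]
  set cs := (entriesOf (lenOf w) w).map encodingIntBool.encode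
  have hmem : encodingIntBool.encode z ∈ decNil (encList cs) := by
    rw [decNil_encList]; exact List.mem_map.2 ⟨z, hz, rfl⟩
  have h1 := two_mul_length_le_of_mem_decNil hmem
  rw [length_encode_int] at h1
  simp only [length_boolPair]
  omega

/-- **The divisor is `2^{ν₂}` of the list gcd** (or irrelevant: all entries vanish). [folklore] -/
theorem divisor_eq (w : List Bool) (hG : listGcd (entriesOf (lenOf w) w) ≠ 0) :
    divisor (entriesOf (lenOf w) w) (canonIV w).length = 2 ^ padicValNat 2 (listGcd (entriesOf (lenOf w) w)) := by
  haveI : Fact (Nat.Prime 2) := ⟨Nat.prime_two⟩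
  set zs := entriesOf (lenOf w) w
  -- some entry is nonzero, and the list gcd divides it
  obtain ⟨z, hz, hz0⟩ : ∃ z ∈ zs, z ≠ 0 := by
    by_contra hall
    push Not at hall
    apply hG
    refine Nat.eq_zero_of_zero_dvd (dvd_listGcd zs fun z hz => ?_)
    simp [hall z hz]
  have hdvd : 2 ^ padicValNat 2 (listGcd zs) ∣ z.natAbs :=
    pow_padicValNat_dvd.trans ((decodeIntVec_oddPartFn_eq.listGcd_dvd zs).2 z hz)
  have hle : 2 ^ padicValNat 2 (listGcd zs) ≤ z.natAbs := Nat.le_of_dvd (Int.natAbs_pos.2 hz0) hdvd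
  have hlt : z.natAbs < 2 ^ (encodeNat z.natAbs).length := by
    conv_lhs => rw [← bitsToNat_encodeNat z.natAbs]
    exact bitsToNat_lt _
  have hL : padicValNat 2 (listGcd zs) ≤ (canonIV w).length := by
    have h := (Nat.pow_lt_pow_iff_right one_lt_two).1 (hle.trans_lt hlt)
    exact (h.le.trans (length_encodeNat_natAbs_le w hz))
  exact gcd_two_pow_eq hG hL

/-- The list gcd of the entries is the gcd-fold over the decoded vector. [folklore] -/
theorem listGcd_entriesOf (w : List Bool) :
    listGcd (entriesOf (lenOf w) w) =
      (List.ofFn fun j : Fin (lenOf w) => ((entriesOf (lenOf w) w).getD j 0).natAbs).foldl Nat.gcd 0 := by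
  rw [listGcd, ← List.foldl_map]
  congr 1
  refine List.ext_getElem (by simp [entriesOf]) fun i h1 h2 => ?_
  have hi : i < (entriesOf (lenOf w) w).length := by simpa using h1
  simp [List.getD_eq_getElem?_getD, List.getElem?_eq_getElem hi]

/-- **Micciancio–Regev 2007, Lemma 5.5 at machine level (semantics of `oddPartFn`).** For every
dimension `m` and EVERY string `w`, the vector read off `oddPartFn w` is the vector `z` read off
`w` divided coordinatewise by `2^i`, `i = ν₂(gcd(… gcd(0,|z₀|) …, |z_{m-1}|))` the largest power
of two dividing all coordinates (junk in, junk out: both sides are `0` when `w` is not the code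
of a dimension-`m` vector). The right-hand side is `SIS.oddPart (decodeIntVec m w)` of
`SISOddPart.lean`, by `rfl`. [cite: MicciancioRegev2007, Lemma 5.5 (proof, full version p. 18)] -/
theorem decodeIntVec_oddPartFn (m : ℕ) (w : List Bool) :
    decodeIntVec m (oddPartFn w) = fun i => decodeIntVec m w i /
      (2 : ℤ) ^ padicValNat 2 ((List.ofFn fun j => (decodeIntVec m w j).natAbs).foldl Nat.gcd 0) := by
  rw [decodeIntVec_oddPartFn_eq, decodeIntVec_eq]
  by_cases hcond : hdrOf w = m ∧ lenOf w = m
  · rw [if_pos hcond, if_pos hcond]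
    obtain ⟨_, hk⟩ := hcond
    subst hk
    rw [← listGcd_entriesOf]
    by_cases hG : listGcd (entriesOf (lenOf w) w) = 0
    · -- all entries vanish
      have hall : ∀ z ∈ entriesOf (lenOf w) w, z = 0 := fun z hz => by
        have := (decodeIntVec_oddPartFn_eq.listGcd_dvd (entriesOf (lenOf w) w)).2 z hz
        rw [hG, zero_dvd_iff] at this
        exact Int.natAbs_eq_zero.1 this
      funext i
      have h0 : (entriesOf (lenOf w) w).getD i 0 = 0 := by
        rw [List.getD_eq_getElem?_getD]
        cases h : (entriesOf (lenOf w) w)[(i : ℕ)]? with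
        | none => rfl
        | some z => exact hall z (List.mem_of_getElem? h)
      change (entriesOf (lenOf w) w).getD i 0 / _ = (entriesOf (lenOf w) w).getD i 0 / _
      rw [h0, Int.zero_ediv, Int.zero_ediv]
    · rw [divisor_eq w hG]
      push_cast
      rfl
  · rw [if_neg hcond, if_neg hcond]
    funext i
    simp

end Literature.Computability.Cryptography.SIS.OddPartFP

end
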